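import Mathlib
import HarnessLib

/-!
# Leading forms under tangent-to-linear substitutions of power series (CDT §2.2)

`Literature/RingTheory/MvPowerSeries/LeadingFormSubst.lean`. Everything here is PROVED (no
definition, no named fact). The "Liouville lower bound" step of F. Calegari, V. Dimitrov, Y. Tang,
*The unbounded denominators conjecture* (J. Amer. Math. Soc. **38** (2025), 627–702;
arXiv:2109.09040), §2.2 (proof of Lemma 2.0.4), rests on two purely formal remarks about a
`d`-variable power series `F(x)` vanishing to exact order `β` at `0` with a lowest-order monomial
`c xⁿ` (`|n| = β`):

* "Since `x(t) ∈ t + t² ℚ⟦t⟧`, the term `c tⁿ` is a lowest order monomial in the formal power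
  series `F(x(t)) ∈ ℤ⟦t⟧`, and so `c ∈ ℤ ∖ {0}`" (display (2.6));
* "the normalizations `h(z) ∈ 1 + z ℂ⟦z⟧` and `φ(z) ∈ φ'(0) z + z² ℂ⟦z⟧` exhibit
  `c φ'(0)^β zⁿ` as a lowest order monomial in `H(z)`" (before display (2.7)).

Both are instances of: substituting `x_s ↦ a_s` with `a_s ≡ λ_s x_s` modulo terms of degree
`≥ 2` into a power series `f` of order `≥ β` multiplies every coefficient of degree `β` by `λⁿ`
(`coeff_subst_of_degree_eq`) and produces no terms of degree `< β`
(`coeff_subst_eq_zero_of_degree_lt`); and multiplying by a unit `u ≡ 1` modulo degree `≥ 1`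
does not change the coefficients of degree `β` (`coeff_mul_of_degree_eq_of_constantCoeff_eq_one`).
Mathlib's substitution `MvPowerSeries.subst` and homogeneous components
(`MvPowerSeries.homogeneousComponent`, whose multiplicativity on leading forms is
`MvPowerSeries.homogeneousComponent_mul_of_le_order`) do all the work.

## References

* [CalegariDimitrovTang2025] F. Calegari, V. Dimitrov, Y. Tang, The unbounded denominators
  conjecture, J. Amer. Math. Soc. 38 (2025), no. 3, 627–702, §2.2, (2.6)–(2.7);
  arXiv:2109.09040.
-/

noncomputable section

open MvPowerSeries Finsupp

namespace Literature.RingTheory.MvPowerSeries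

variable {σ : Type*} {R : Type*} [CommRing R]

/-! ### 1. Leading forms of powers and products -/

/-- `homogeneousComponent 0 1 = 1`. [folklore] -/
theorem homogeneousComponent_zero_one :
    homogeneousComponent 0 (1 : MvPowerSeries σ R) = 1 := by
  classical
  ext d
  rw [coeff_homogeneousComponent, coeff_one]
  by_cases hd : d = 0
  · simp [hd]
  · rw [if_neg hd, if_neg]
    exact fun h0 ↦ hd ((Finsupp.degree_eq_zero_iff d).mp h0)

/-- The leading form of a product over a finset is the product of the leading forms:
if `p s ≤ order (g s)` for all `s ∈ S`, then
`homogeneousComponent (∑ p) (∏ g) = ∏ homogeneousComponent (p s) (g s)`. [folklore] -/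
theorem homogeneousComponent_prod_of_le_order (S : Finset σ) (g : σ → MvPowerSeries σ R)
    (p : σ → ℕ) (h : ∀ s ∈ S, (p s : ℕ∞) ≤ (g s).order) :
    homogeneousComponent (∑ s ∈ S, p s) (∏ s ∈ S, g s) =
      ∏ s ∈ S, homogeneousComponent (p s) (g s) := by
  classical
  induction S using Finset.induction_on with
  | empty => simpa using homogeneousComponent_zero_one
  | insert a S haS ih =>
    rw [Finset.sum_insert haS, Finset.prod_insert haS, Finset.prod_insert haS]
    have hS : ∀ s ∈ S, (p s : ℕ∞) ≤ (g s).order := fun s hs ↦ h s (Finset.mem_insert_of_mem hs)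
    have hordS : ((∑ s ∈ S, p s : ℕ) : ℕ∞) ≤ (∏ s ∈ S, g s).order := by
      refine le_trans ?_ (le_order_prod g S)
      push_cast
      exact Finset.sum_le_sum hS
    rw [homogeneousComponent_mul_of_le_order (h a (Finset.mem_insert_self a S)) hordS, ih hS]

/-- The leading form of a power: if `1 ≤ order g` and `homogeneousComponent 1 g = ℓ`, then
`homogeneousComponent n (gⁿ) = ℓⁿ`. [folklore] -/
theorem homogeneousComponent_pow_of_one_le_order (g : MvPowerSeries σ R) (hg : (1 : ℕ∞) ≤ g.order)
    (n : ℕ) : homogeneousComponent n (g ^ n) = (homogeneousComponent 1 g) ^ n := by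
  induction n with
  | zero => simpa using homogeneousComponent_zero_one
  | succ n ih =>
    have hn : (n : ℕ∞) ≤ (g ^ n).order :=
      le_order_pow_of_constantCoeff_eq_zero n (one_le_order_iff_constCoeff_eq_zero.mp hg)
    rw [pow_succ, pow_succ, homogeneousComponent_mul_of_le_order hn hg, ih]

/-! ### 2. Substitutions tangent to a linear (diagonal) map -/

variable {a : σ → MvPowerSeries σ R} {lam : σ → R}

/-- Under a substitution `x_s ↦ a_s` with `a_s(0) = 0`, the order does not decrease:
coefficients of degree `< order f` of `f(a)` vanish. [folklore] -/
theorem coeff_subst_eq_zero_of_degree_lt [Finite σ] (ha0 : ∀ s, constantCoeff (a s) = 0)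
    (f : MvPowerSeries σ R) {e : σ →₀ ℕ} (he : (e.degree : ℕ∞) < f.order) :
    coeff e (f.subst a) = 0 := by
  apply coeff_of_lt_order
  refine lt_of_lt_of_le he (le_trans ?_ (le_order_subst (hasSubst_of_constantCoeff_zero ha0) f))
  have h1 : (1 : ℕ∞) ≤ ⨅ i, (a i).order :=
    le_iInf fun i ↦ one_le_order_iff_constCoeff_eq_zero.mpr (ha0 i)
  simpa using mul_le_mul' h1 (le_refl f.order)

/-- Products of scaled monomials: `∏_{s ∈ S} c_s · x_s^{k_s} = (∏ c_s) · x^{∑ k_s e_s}`. [folklore] -/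
theorem prod_smul_monomial_single (S : Finset σ) (c : σ → R) (k : σ → ℕ) :
    ∏ s ∈ S, c s • monomial (single s (k s)) (1 : R) =
      monomial (∑ s ∈ S, single s (k s)) (∏ s ∈ S, c s) := by
  classical
  induction S using Finset.induction_on with
  | empty => simp
  | insert b S hbS ih =>
    rw [Finset.prod_insert hbS, Finset.sum_insert hbS, Finset.prod_insert hbS, ih, smul_mul_assoc,
      monomial_mul_monomial, one_mul, ← LinearMap.map_smul, smul_eq_mul]

/-- The order of `∏_s a_s^{d_s}` is at least `|d|` when every `a_s` vanishes at `0`. [folklore] -/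
theorem degree_le_order_prod_pow (ha0 : ∀ s, constantCoeff (a s) = 0) (d : σ →₀ ℕ) :
    (d.degree : ℕ∞) ≤ (d.prod fun s n ↦ (a s) ^ n).order := by
  classical
  rw [degree_apply, Finsupp.prod]
  refine le_trans ?_ (le_order_prod (fun s ↦ a s ^ d s) d.support)
  push_cast
  exact Finset.sum_le_sum fun s _ ↦ le_order_pow_of_constantCoeff_eq_zero (d s) (ha0 s)

/-- The leading form of `∏_s a_s^{d_s}` for `a_s = λ_s x_s + (degree ≥ 2)`: in degree `|d|` it is
`(∏ λ_s^{d_s}) x^d`. [folklore] -/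
theorem homogeneousComponent_prod_pow_subst (ha0 : ∀ s, constantCoeff (a s) = 0)
    (ha1 : ∀ s, homogeneousComponent 1 (a s) = lam s • X s) (d : σ →₀ ℕ) :
    homogeneousComponent d.degree (d.prod fun s n ↦ (a s) ^ n) =
      monomial d (d.prod fun s n ↦ lam s ^ n) := by
  classical
  have hord : ∀ s, (1 : ℕ∞) ≤ (a s).order := fun s ↦
    one_le_order_iff_constCoeff_eq_zero.mpr (ha0 s)
  rw [degree_apply, Finsupp.prod, Finsupp.prod]
  rw [homogeneousComponent_prod_of_le_order d.support (fun s ↦ a s ^ d s) (fun s ↦ d s)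
    (fun s _ ↦ le_order_pow_of_constantCoeff_eq_zero (d s) (ha0 s))]
  simp_rw [homogeneousComponent_pow_of_one_le_order _ (hord _), ha1, smul_pow, X_pow_eq]
  rw [prod_smul_monomial_single, show (∑ s ∈ d.support, single s (d s)) = d from d.sum_single]

/-- **Leading coefficients under a substitution tangent to a diagonal linear map** (CDT §2.2:
"`c tⁿ` is a lowest order monomial in `F(x(t))`" for `x(t) ∈ t + t²ℚ⟦t⟧`, and "`c φ'(0)^β zⁿ` is
a lowest order monomial in `H(z)`" for `φ(z) ∈ φ'(0) z + z²ℂ⟦z⟧`). Let `f` be a power series of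
order `≥ β` in finitely many variables and substitute `x_s ↦ a_s` with `a_s(0) = 0` and linear part
`λ_s x_s`. Then for every multi-index `e` of degree `β`,
`[xᵉ] f(a) = λᵉ · [xᵉ] f`, `λᵉ = ∏_s λ_s^{e_s}`. [cite: CalegariDimitrovTang2025, §2.2, (2.6)] -/
theorem coeff_subst_of_degree_eq [Finite σ] (ha0 : ∀ s, constantCoeff (a s) = 0)
    (ha1 : ∀ s, homogeneousComponent 1 (a s) = lam s • X s) (f : MvPowerSeries σ R) {β : ℕ}
    (hf : (β : ℕ∞) ≤ f.order) {e : σ →₀ ℕ} (he : e.degree = β) :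
    coeff e (f.subst a) = (e.prod fun s n ↦ lam s ^ n) * coeff e f := by
  classical
  -- the coefficient of `xᵉ` in `∏_s a_s^{d_s}`
  have key : ∀ d : σ →₀ ℕ, d.degree = β →
      coeff e (d.prod fun s n ↦ (a s) ^ n) = if e = d then d.prod fun s n ↦ lam s ^ n else 0 := by
    intro d hd
    have h1 : coeff e (d.prod fun s n ↦ (a s) ^ n) =
        coeff e (homogeneousComponent d.degree (d.prod fun s n ↦ (a s) ^ n)) := by
      rw [coeff_homogeneousComponent, if_pos (by rw [he, hd])]
    rw [h1, homogeneousComponent_prod_pow_subst ha0 ha1, coeff_monomial]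
  rw [coeff_subst (hasSubst_of_constantCoeff_zero ha0), finsum_eq_single _ e]
  · rw [key e he, if_pos rfl, smul_eq_mul, mul_comm]
  · intro d hde
    rcases lt_trichotomy d.degree β with hlt | heq | hgt
    · have hlt' : (d.degree : ℕ∞) < f.order := lt_of_lt_of_le (by exact_mod_cast hlt) hf
      rw [coeff_of_lt_order hlt', zero_smul]
    · rw [key d heq, if_neg (Ne.symm hde), smul_zero]
    · have hgt' : (e.degree : ℕ∞) < (d.prod fun s n ↦ (a s) ^ n).order :=
        lt_of_lt_of_le (by rw [he]; exact_mod_cast hgt) (degree_le_order_prod_pow ha0 d)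
      rw [coeff_of_lt_order hgt', smul_zero]

/-- **Units do not change the leading form** (CDT §2.2: the normalization `h(z) ∈ 1 + zℂ⟦z⟧`):
if `u(0) = 1` and `f` has order `≥ β`, then `[xᵉ](u f) = [xᵉ] f` for every `e` of degree `β`.
[cite: CalegariDimitrovTang2025, §2.2] -/
theorem coeff_mul_of_degree_eq_of_constantCoeff_eq_one {u f : MvPowerSeries σ R}
    (hu : constantCoeff u = 1) {β : ℕ} (hf : (β : ℕ∞) ≤ f.order) {e : σ →₀ ℕ}
    (he : e.degree = β) : coeff e (u * f) = coeff e f := by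
  have hv : (1 : ℕ∞) ≤ (u - 1).order := by
    rw [one_le_order_iff_constCoeff_eq_zero]
    simp [hu]
  have hsplit : u * f = f + (u - 1) * f := by ring
  have hzero : coeff e ((u - 1) * f) = 0 := by
    apply coeff_of_lt_order
    refine lt_of_lt_of_le ?_ (le_order_mul)
    calc (e.degree : ℕ∞) < ((β + 1 : ℕ) : ℕ∞) := by rw [he]; exact_mod_cast Nat.lt_succ_self β
      _ = 1 + (β : ℕ∞) := by push_cast; ring
      _ ≤ (u - 1).order + f.order := add_le_add hv hf
  rw [hsplit, map_add, hzero, add_zero]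

end Literature.RingTheory.MvPowerSeries
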